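import Mathlib
import HarnessLib
import Summits.CriticalPhenomena.CardyFormulaZ2.Theorems.CardyMagicRigidityMagicFormulaTStubNormalFamily

/-!
# Line `Sketch` (v9) for crux `MagicFormulaT`, sub-goal AP `ap_expMoment_powerSums`: uniform-in-mesh
# exponential moments of all orders of the nesting power sums `A₁ = Σ_u θ_u`, `A₂ = Σ_u θ_u²`

Crux `Summit.CriticalPhenomena.CardyFormulaZ2.Theses.CardyMagicRigidity.MagicFormulaT`
(stmt-CriticalPhenomena-4836), line `Sketch`, skeleton v9, registered sub-goal `ap_expMoment_powerSums`
(wave 3): for an admissible density `f` (measurable, `|f| ≤ C`, `f = 0` off `B̄(0, R)`, `∫ f = 0`) and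
every real `s` there is `M` with, for all small meshes `δ` (in fact all `0 < δ ≤ 1`),
`E_{1/2} exp(s A₁) ≤ M` and `E_{1/2} exp(s A₂) ≤ M` (integrability included), where
`A₁ = Σ_u θ_u`, `A₂ = Σ_u θ_u²`, `θ_u = u.nestingPhase f` over the loops of `siteLoopConfig δ ω` under
`triSitePercolation half` (the ensemble `tEns`).

Proof (the real-coupling UV machine of `stub_normalFamily`, without complex analysis).  Pathwise only the
finitely many loops meeting `B̄(0, R)` contribute (`sw_meets_of_nestingPhase_ne_zero`,
`ConeTilt.finite_loops_meeting`), so `Σ_u φ(θ_u) = Θ_φ + B_φ` (`ap_finsum_eq_band_add_big`), with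
`Θ_φ` the inner statistic over `B(0, |R| + 2)` of the band-restricted `φ(θ_u)` (band `diam < b`,
`b = 1`; `nf_finsum_band_eq_sum`) and `|B_φ| ≤ K_φ N_b`, `N_b` the number of loops of diameter `≥ b`
meeting `B̄(0, max R b)` (`nf_card_filter_big_le`), `K_φ = sup |φ(θ_u)|` (`K = C · Leb(B̄(0,R))` for
`φ = id`, `K²` for `φ = (·)²`, `abs_nestingPhase_le_mul_volume_closedBall`).  AM–GM:
`exp(s Σ_u φ(θ_u)) ≤ ½ exp(2s Θ_φ) + ½ exp(2|s| K_φ N_b)` (`ap_exp_finsum_le`).  Uniformly in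
`0 < δ ≤ b`: `E exp(2|s| K_φ N_b) ≤ C_K` (keystone `expMoment_ncard_bigLoops_meeting_le_ball`);
`E exp(2s Θ_id) ≤ exp(K₀ (2s)² (πC)² (|R|+2)³ b)` (`stub_bandExpMoment` and the EXACT centring
`E Θ_id = 0`, `stub_bandCentring`); `E exp(2s Θ_sq) ≤ e^{2s E Θ_sq} E e^{2s(Θ_sq − EΘ_sq)}` with
`|E Θ_sq| ≤ K₁ (πC)² (|R|+2)² b²` (`stub_bandFirstMoment`) and `stub_bandExpMoment` again
(`|θ_u²| ≤ (πC)² b² diam²` on the band).  Measurability of `ω ↦ Σ_u φ(θ_u)` is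
`FirstMoment.measurable_finsum_loops`.  No named fact is used; no definition is introduced.
-/

noncomputable section

namespace Summit.CriticalPhenomena.CardyFormulaZ2.Cruxes.MagicFormulaT.LineSketch

open MeasureTheory Filter Set Metric
open scoped Real Topology BigOperators ENNReal
open Literature.Probability.RandomPlanarGeometry Literature.Probability.Percolation
  Literature.Probability.LatticeModels
open Summit.CriticalPhenomena.CardyFormulaZ2.Cruxes.NestingRigidity.RingCloudTomography
open Summit.CriticalPhenomena.CardyFormulaZ2.Cruxes.NestingRigidity.PositiveConeWeightDoubling

/-! ## An elementary inequality -/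

/-- AM–GM for two exponentials: `eˣ eʸ ≤ ½ e^{2x} + ½ e^{2y}`. -/
theorem ap_exp_mul_exp_le (x y : ℝ) :
    Real.exp x * Real.exp y ≤ 1 / 2 * Real.exp (2 * x) + 1 / 2 * Real.exp (2 * y) := by
  have e2x : Real.exp (2 * x) = Real.exp x ^ 2 := by rw [sq, ← Real.exp_add, two_mul]
  have e2y : Real.exp (2 * y) = Real.exp y ^ 2 := by rw [sq, ← Real.exp_add, two_mul]
  rw [e2x, e2y]
  nlinarith [sq_nonneg (Real.exp x - Real.exp y)]

/-! ## Pathwise: a loop family with finitely many loops meeting the ball -/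

section Family

variable {f : ℂ → ℝ} {R C : ℝ}

/-- **Pathwise UV split of a power sum**: if finitely many loops of `L` meet `B̄(0, R)`, `φ 0 = 0` and
`b ≤ 1`, then `Σ_{u ∈ L} φ(θ_u)` is the inner statistic over `B(0, |R| + 2)` of the band-restricted
`φ(θ_u)` (band `diam < b`) plus the honest finite sum of `φ(θ_u)` over the loops of diameter `≥ b`
meeting `B̄(0, R)`. -/
theorem ap_finsum_eq_band_add_big (hR : ∀ z, R < ‖z‖ → f z = 0) (h0 : ∫ z, f z = 0) {b : ℝ}
    (hb1 : b ≤ 1) {L : Set (UnbasedLoop ℂ)}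
    (hfin : {u ∈ L | (u.range ∩ closedBall (0 : ℂ) R).Nonempty}.Finite) (φ : ℝ → ℝ)
    (hφ : φ 0 = 0) :
    ∑ᶠ u ∈ L, φ (u.nestingPhase f) =
      (∑ᶠ u ∈ {u ∈ L | u.range ⊆ ball (0 : ℂ) (|R| + 2)},
          (if 0 ≤ diam u.range ∧ diam u.range < b then φ (u.nestingPhase f) else 0)) +
        ∑ u ∈ hfin.toFinset with ¬diam u.range < b, φ (u.nestingPhase f) := by
  have h1 : ∑ᶠ u ∈ L, φ (u.nestingPhase f) = ∑ u ∈ hfin.toFinset, φ (u.nestingPhase f) := by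
    refine finsum_mem_eq_sum_of_subset _ (fun u hu ↦ hfin.mem_toFinset.2 ⟨hu.1, ?_⟩)
      (fun u hu ↦ (hfin.mem_toFinset.1 hu).1)
    have hθ : u.nestingPhase f ≠ 0 := fun h ↦
      (Function.mem_support.1 hu.2) (show φ (u.nestingPhase f) = 0 by rw [h, hφ])
    exact sw_meets_of_nestingPhase_ne_zero hR h0 hθ
  rw [h1, nf_finsum_band_eq_sum hR h0 hb1 hfin φ hφ,
    Finset.sum_filter_add_sum_filter_not hfin.toFinset (fun u ↦ diam u.range < b)]

/-- **Pathwise bound on `exp(s Σ_u φ(θ_u))`** over a loop family with finitely many loops meeting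
`B̄(0, R')`, `R ≤ R'`, for `φ 0 = 0`, `|φ(θ_u)| ≤ K_φ` (`K_φ ≥ 0`) and `b ≤ 1`:
`exp(s Σ_u φ(θ_u)) ≤ ½ exp(2s Θ_φ) + ½ exp(2|s| K_φ N_b)`, `Θ_φ` the inner statistic over
`B(0, |R| + 2)` of the band-restricted `φ(θ_u)` and `N_b` the number of loops of diameter `≥ b` meeting
`B̄(0, R')` (UV split, `|Σ_{big} φ(θ_u)| ≤ K_φ N_b`, AM–GM). -/
theorem ap_exp_finsum_le (hR : ∀ z, R < ‖z‖ → f z = 0) (h0 : ∫ z, f z = 0) {b R' Kφ : ℝ}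
    (hb1 : b ≤ 1) (hRR' : R ≤ R') (hK0 : 0 ≤ Kφ) {L : Set (UnbasedLoop ℂ)}
    (hfin : {u ∈ L | (u.range ∩ closedBall (0 : ℂ) R).Nonempty}.Finite)
    (hfin' : {u ∈ L | (u.range ∩ closedBall (0 : ℂ) R').Nonempty}.Finite) (φ : ℝ → ℝ)
    (hφ : φ 0 = 0) (hKφ : ∀ u : UnbasedLoop ℂ, |φ (u.nestingPhase f)| ≤ Kφ) (s : ℝ) :
    Real.exp (s * ∑ᶠ u ∈ L, φ (u.nestingPhase f)) ≤
      1 / 2 * Real.exp (2 * s * ∑ᶠ u ∈ {u ∈ L | u.range ⊆ ball (0 : ℂ) (|R| + 2)},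
          (if 0 ≤ diam u.range ∧ diam u.range < b then φ (u.nestingPhase f) else 0)) +
      1 / 2 * Real.exp (2 * (|s| * Kφ) *
          ({u ∈ L | (u.range ∩ closedBall (0 : ℂ) R').Nonempty ∧ b ≤ diam u.range}.ncard : ℝ)) := by
  have hB : |∑ u ∈ hfin.toFinset with ¬diam u.range < b, φ (u.nestingPhase f)| ≤
      Kφ * ({u ∈ L | (u.range ∩ closedBall (0 : ℂ) R').Nonempty ∧ b ≤ diam u.range}.ncard : ℝ) := by
    refine (Finset.abs_sum_le_sum_abs _ _).trans ((Finset.sum_le_sum fun u _ ↦ hKφ u).trans ?_)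
    rw [Finset.sum_const, nsmul_eq_mul']
    exact mul_le_mul_of_nonneg_left
      (by exact_mod_cast nf_card_filter_big_le (b := b) hRR' hfin hfin') hK0
  have hsB : s * ∑ u ∈ hfin.toFinset with ¬diam u.range < b, φ (u.nestingPhase f) ≤
      |s| * Kφ * ({u ∈ L | (u.range ∩ closedBall (0 : ℂ) R').Nonempty ∧ b ≤ diam u.range}.ncard : ℝ) :=
    calc s * ∑ u ∈ hfin.toFinset with ¬diam u.range < b, φ (u.nestingPhase f)
        ≤ |s * ∑ u ∈ hfin.toFinset with ¬diam u.range < b, φ (u.nestingPhase f)| := le_abs_self _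
      _ = |s| * |∑ u ∈ hfin.toFinset with ¬diam u.range < b, φ (u.nestingPhase f)| := abs_mul _ _
      _ ≤ |s| * (Kφ * ({u ∈ L | (u.range ∩ closedBall (0 : ℂ) R').Nonempty ∧
            b ≤ diam u.range}.ncard : ℝ)) := mul_le_mul_of_nonneg_left hB (abs_nonneg _)
      _ = _ := by ring
  rw [ap_finsum_eq_band_add_big hR h0 hb1 hfin φ hφ, mul_add, Real.exp_add]
  refine ((mul_le_mul_of_nonneg_left (Real.exp_le_exp.2 hsB) (Real.exp_pos _).le).trans
    (ap_exp_mul_exp_le _ _)).trans_eq ?_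
  simp only [mul_assoc]

end Family

/-! ## The registered sub-goal -/

/-- **Sub-goal AP (`ap_expMoment_powerSums`) · uniform-in-mesh exponential moments of ALL orders of the
nesting power sums** `A₁ = Σ_u θ_u`, `A₂ = Σ_u θ_u²` (a priori bounds for the order-2/3 limit passages of
line `Sketch` v9): for an admissible density `f` and every real `s` there is `M` with
`E exp(s A₁) ≤ M`, `E exp(s A₂) ≤ M` (integrability included), eventually as `δ → 0⁺` (in fact for all
`0 < δ ≤ 1`).  UV split at diameter `b = 1`: big loops by the keystone exponential moments of their
number, small loops by the band exponential moments, the exact band centring and the band first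
moments; AM–GM in between.  See the module docstring. -/
theorem ap_expMoment_powerSums : ∀ (f : ℂ → ℝ) (R C : ℝ), Measurable f → (∀ z, |f z| ≤ C) →
    (∀ z, R < ‖z‖ → f z = 0) → ∫ z, f z = 0 → ∀ s : ℝ, ∃ M : ℝ, ∀ᶠ δ in 𝓝[>] (0 : ℝ),
    Integrable (fun ω ↦ Real.exp (s * ∑ᶠ u ∈ (siteLoopConfig δ ω).loops, u.nestingPhase f))
      (triSitePercolation half) ∧
    ∫ ω, Real.exp (s * ∑ᶠ u ∈ (siteLoopConfig δ ω).loops, u.nestingPhase f) ∂(triSitePercolation half) ≤ M ∧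
    Integrable (fun ω ↦ Real.exp (s * ∑ᶠ u ∈ (siteLoopConfig δ ω).loops, u.nestingPhase f ^ 2))
      (triSitePercolation half) ∧
    ∫ ω, Real.exp (s * ∑ᶠ u ∈ (siteLoopConfig δ ω).loops, u.nestingPhase f ^ 2) ∂(triSitePercolation half) ≤ M := by
  intro f R C hf hC hR h0 s
  have hC0 : 0 ≤ C := nonneg_of_abs_le hC
  /- constants attached to `f` and `s` -/
  set κ₁ : ℝ := π * C
  have hκ₁0 : 0 ≤ κ₁ := by positivity
  set K : ℝ := C * volume.real (closedBall (0 : ℂ) R)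
  have hK0 : 0 ≤ K := mul_nonneg hC0 measureReal_nonneg
  have hθK : ∀ u : UnbasedLoop ℂ, |u.nestingPhase f| ≤ K :=
    fun u ↦ abs_nestingPhase_le_mul_volume_closedBall hC hR u
  have hθK2 : ∀ u : UnbasedLoop ℂ, |u.nestingPhase f ^ 2| ≤ K ^ 2 := fun u ↦ by
    rw [abs_pow]; exact pow_le_pow_left₀ (abs_nonneg _) (hθK u) 2
  obtain ⟨b, hb0, hb1⟩ : ∃ b : ℝ, 0 < b ∧ b ≤ 1 := ⟨1, one_pos, le_rfl⟩
  have hbρs : b ≤ |R| + 2 := by linarith [abs_nonneg R]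
  set R' : ℝ := max R b
  /- the keystone (big loops) and the band moment constants -/
  obtain ⟨CK, -, hK6⟩ := expMoment_ncard_bigLoops_meeting_le_ball tEns tEns_mem (2 * (|s| * K))
    R' b hb0 (le_max_right _ _)
  obtain ⟨CK', -, hK6'⟩ := expMoment_ncard_bigLoops_meeting_le_ball tEns tEns_mem
    (2 * (|s| * K ^ 2)) R' b hb0 (le_max_right _ _)
  obtain ⟨K₀, -, hS1⟩ := stub_bandExpMoment tEns tEns_mem (|2 * s| * κ₁ * (|R| + 2) ^ 2)
  obtain ⟨K₀', -, hS1'⟩ :=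
    stub_bandExpMoment tEns tEns_mem (|2 * s| * (κ₁ ^ 2 * b ^ 2) * (|R| + 2) ^ 2)
  obtain ⟨K₁, -, hS2⟩ := stub_bandFirstMoment tEns tEns_mem
  set EY : ℝ := Real.exp (K₀ * (2 * s) ^ 2 * κ₁ ^ 2 * (|R| + 2) ^ 3 * b)
  set EZ : ℝ := Real.exp (|2 * s| * (K₁ * κ₁ ^ 2 * (|R| + 2) ^ 2 * b ^ 2)) *
    Real.exp (K₀' * (2 * s) ^ 2 * (κ₁ ^ 2 * b ^ 2) ^ 2 * (|R| + 2) ^ 3 * b)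
  refine ⟨max (1 / 2 * EY + 1 / 2 * CK) (1 / 2 * EZ + 1 / 2 * CK'), ?_⟩
  filter_upwards [Ioc_mem_nhdsGT hb0] with δ ⟨hδ0, hδb⟩
  /- the statistics at mesh `δ` -/
  set D : Set ℂ := ball (0 : ℂ) (|R| + 2)
  set gs : UnbasedLoop ℂ → ℝ := fun u ↦
    if 0 ≤ diam u.range ∧ diam u.range < b then u.nestingPhase f else 0
  set g2 : UnbasedLoop ℂ → ℝ := fun u ↦
    if 0 ≤ diam u.range ∧ diam u.range < b then u.nestingPhase f ^ 2 else 0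
  set Θs : tEns.Ω → ℝ := fun ω ↦ ∑ᶠ u ∈ {u ∈ (tEns.X δ ω).loops | u.range ⊆ D}, gs u
  set Θ₂ : tEns.Ω → ℝ := fun ω ↦ ∑ᶠ u ∈ {u ∈ (tEns.X δ ω).loops | u.range ⊆ D}, g2 u
  set Nb : tEns.Ω → ℕ := fun ω ↦ {u ∈ (tEns.X δ ω).loops |
    (u.range ∩ closedBall (0 : ℂ) R').Nonempty ∧ b ≤ diam u.range}.ncard
  set A₁ : tEns.Ω → ℝ := fun ω ↦ ∑ᶠ u ∈ (tEns.X δ ω).loops, u.nestingPhase f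
  set A₂ : tEns.Ω → ℝ := fun ω ↦ ∑ᶠ u ∈ (tEns.X δ ω).loops, u.nestingPhase f ^ 2
  /- the pointwise majorants: UV split + AM–GM -/
  have hpt1 : ∀ ω, Real.exp (s * A₁ ω) ≤ 1 / 2 * Real.exp (2 * s * Θs ω) +
      1 / 2 * Real.exp (2 * (|s| * K) * (Nb ω : ℝ)) := fun ω ↦
    ap_exp_finsum_le hR h0 hb1 (le_max_left _ _) hK0
      (ConeTilt.finite_loops_meeting tEns tEns_mem hδ0 ω R)
      (ConeTilt.finite_loops_meeting tEns tEns_mem hδ0 ω R') (fun x ↦ x) rfl hθK s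
  have hpt2 : ∀ ω, Real.exp (s * A₂ ω) ≤ 1 / 2 * Real.exp (2 * s * Θ₂ ω) +
      1 / 2 * Real.exp (2 * (|s| * K ^ 2) * (Nb ω : ℝ)) := fun ω ↦
    ap_exp_finsum_le hR h0 hb1 (le_max_left _ _) (sq_nonneg K)
      (ConeTilt.finite_loops_meeting tEns tEns_mem hδ0 ω R)
      (ConeTilt.finite_loops_meeting tEns tEns_mem hδ0 ω R') (fun x ↦ x ^ 2) (by norm_num) hθK2 s
  /- measurability of the power sums -/
  have hmA₁ : Measurable A₁ :=
    FirstMoment.measurable_finsum_loops tEns tEns_mem δ (fun u ↦ u.nestingPhase f)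
  have hmA₂ : Measurable A₂ :=
    FirstMoment.measurable_finsum_loops tEns tEns_mem δ (fun u ↦ u.nestingPhase f ^ 2)
  /- dominations of the band statistics -/
  have hdom : ∀ u : UnbasedLoop ℂ, u.range ⊆ D →
      |gs u| ≤ κ₁ * diam u.range ^ 2 := fun u _ ↦ uva_band_dom_sq hC hR 0 b u
  have hdom4 : ∀ u : UnbasedLoop ℂ, u.range ⊆ D →
      |g2 u| ≤ κ₁ ^ 2 * diam u.range ^ 4 := fun u _ ↦ uva_band_dom_four hC hR 0 b u
  have hvan2 : ∀ u : UnbasedLoop ℂ, u.range ⊆ D → b ≤ diam u.range →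
      g2 u = 0 := fun u _ hbu ↦ uva_band_vanish hbu _
  have hdom2 : ∀ u : UnbasedLoop ℂ, u.range ⊆ D →
      |g2 u| ≤ κ₁ ^ 2 * b ^ 2 * diam u.range ^ 2 := by
    intro u hu
    rcases lt_or_ge (diam u.range) b with h | h
    · calc |g2 u| ≤ κ₁ ^ 2 * diam u.range ^ 4 := hdom4 u hu
        _ = κ₁ ^ 2 * diam u.range ^ 2 * diam u.range ^ 2 := by ring
        _ ≤ κ₁ ^ 2 * b ^ 2 * diam u.range ^ 2 := by
            gcongr _ * ?_ * _
            exact pow_le_pow_left₀ diam_nonneg h.le 2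
    · rw [hvan2 u hu h, abs_zero]; positivity
  /- the keystones at mesh `δ` -/
  have hK6δ := hK6 0 1 δ one_pos hδ0
  have hK6δ' := hK6' 0 1 δ one_pos hδ0
  simp only [one_mul] at hK6δ hK6δ'
  /- exact centring and the exponential moment of `Θ_s` -/
  have hcs : ∫ ω', (∑ᶠ u ∈ {u ∈ (tEns.X δ ω').loops | u.range ⊆ D}, gs u) ∂tEns.P = 0 := by
    refine Eq.trans (integral_congr_ae (Eventually.of_forall fun ω ↦ ?_))
      (stub_bandCentring tEns tEns_mem f R C δ b hf hC hR h0 hδ0)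
    have h1 := nf_finsum_band_eq_sum hR h0 hb1
      (ConeTilt.finite_loops_meeting tEns tEns_mem hδ0 ω R) (fun x ↦ x) rfl
    have h2 : ∑ᶠ u ∈ {u ∈ (tEns.X δ ω).loops | diam u.range < b}, u.nestingPhase f =
        ∑ u ∈ (ConeTilt.finite_loops_meeting tEns tEns_mem hδ0 ω R).toFinset with diam u.range < b,
          u.nestingPhase f := by
      refine finsum_mem_eq_sum_of_subset _ (fun u hu ↦ ?_) (fun u hu ↦ ?_)
      · rw [Finset.coe_filter, Set.mem_setOf_eq, Set.Finite.mem_toFinset]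
        exact ⟨⟨hu.1.1, sw_meets_of_nestingPhase_ne_zero hR h0 (Function.mem_support.1 hu.2)⟩,
          hu.1.2⟩
      · rw [Finset.coe_filter, Set.mem_setOf_eq, Set.Finite.mem_toFinset] at hu
        exact ⟨hu.1.1, hu.2⟩
    exact h1.trans h2.symm
  have hS1s := hS1 0 (|R| + 2) κ₁ (2 * s) δ b D gs hδ0 hδb hbρs hκ₁0 subset_rfl hdom
    (fun u _ hbu ↦ uva_band_vanish hbu _) le_rfl
  simp only [hcs, sub_zero] at hS1s
  have hIY : Integrable (fun ω ↦ Real.exp (2 * s * Θs ω)) tEns.P := hS1s.1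
  have hEY : ∫ ω, Real.exp (2 * s * Θs ω) ∂tEns.P ≤ EY := hS1s.2
  /- first and exponential moments of `Θ₂` -/
  have hS2' := hS2 0 (|R| + 2) (κ₁ ^ 2) δ b D g2 hδ0 hδb hbρs (by positivity) subset_rfl hdom4
    hvan2
  have hS1z := hS1' 0 (|R| + 2) (κ₁ ^ 2 * b ^ 2) (2 * s) δ b D g2 hδ0 hδb hbρs (by positivity)
    subset_rfl hdom2 hvan2 le_rfl
  set m : ℝ := ∫ ω', (∑ᶠ u ∈ {u ∈ (tEns.X δ ω').loops | u.range ⊆ D}, g2 u) ∂tEns.P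
  have hm_le : |m| ≤ K₁ * κ₁ ^ 2 * (|R| + 2) ^ 2 * b ^ 2 :=
    abs_integral_le_integral_abs.trans hS2'.2
  have hexp2 : ∀ ω, Real.exp (2 * s * Θ₂ ω) =
      Real.exp (2 * s * m) * Real.exp (2 * s * (Θ₂ ω - m)) :=
    fun ω ↦ by rw [← Real.exp_add]; congr 1; ring
  have hIZ : Integrable (fun ω ↦ Real.exp (2 * s * Θ₂ ω)) tEns.P := by
    simp_rw [hexp2]
    exact hS1z.1.const_mul _
  have hEZ : ∫ ω, Real.exp (2 * s * Θ₂ ω) ∂tEns.P ≤ EZ := by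
    simp_rw [hexp2]
    rw [integral_const_mul]
    refine mul_le_mul (Real.exp_le_exp.2 ?_) hS1z.2 (integral_nonneg fun _ ↦ (Real.exp_pos _).le)
      (Real.exp_pos _).le
    calc 2 * s * m ≤ |2 * s * m| := le_abs_self _
      _ = |2 * s| * |m| := abs_mul _ _
      _ ≤ |2 * s| * (K₁ * κ₁ ^ 2 * (|R| + 2) ^ 2 * b ^ 2) :=
          mul_le_mul_of_nonneg_left hm_le (abs_nonneg _)
  /- assembly: order one -/
  have hIa : Integrable (fun ω ↦ 1 / 2 * Real.exp (2 * s * Θs ω)) tEns.P := hIY.const_mul _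
  have hIb : Integrable (fun ω ↦ 1 / 2 * Real.exp (2 * (|s| * K) * (Nb ω : ℝ))) tEns.P :=
    hK6δ.1.const_mul _
  have hmaj : Integrable (fun ω ↦ 1 / 2 * Real.exp (2 * s * Θs ω) +
      1 / 2 * Real.exp (2 * (|s| * K) * (Nb ω : ℝ))) tEns.P := hIa.add hIb
  have hI1 : Integrable (fun ω ↦ Real.exp (s * A₁ ω)) tEns.P :=
    hmaj.mono' (hmA₁.const_mul s).exp.aestronglyMeasurable (Eventually.of_forall fun ω ↦
      (Real.norm_of_nonneg (Real.exp_pos _).le).trans_le (hpt1 ω))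
  have hE1 : ∫ ω, Real.exp (s * A₁ ω) ∂tEns.P ≤ 1 / 2 * EY + 1 / 2 * CK := by
    refine (integral_mono hI1 hmaj hpt1).trans ?_
    rw [integral_add hIa hIb, integral_const_mul, integral_const_mul]
    exact add_le_add (mul_le_mul_of_nonneg_left hEY (by norm_num))
      (mul_le_mul_of_nonneg_left hK6δ.2 (by norm_num))
  /- assembly: order two -/
  have hIa' : Integrable (fun ω ↦ 1 / 2 * Real.exp (2 * s * Θ₂ ω)) tEns.P := hIZ.const_mul _
  have hIb' : Integrable (fun ω ↦ 1 / 2 * Real.exp (2 * (|s| * K ^ 2) * (Nb ω : ℝ))) tEns.P :=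
    hK6δ'.1.const_mul _
  have hmaj' : Integrable (fun ω ↦ 1 / 2 * Real.exp (2 * s * Θ₂ ω) +
      1 / 2 * Real.exp (2 * (|s| * K ^ 2) * (Nb ω : ℝ))) tEns.P := hIa'.add hIb'
  have hI2 : Integrable (fun ω ↦ Real.exp (s * A₂ ω)) tEns.P :=
    hmaj'.mono' (hmA₂.const_mul s).exp.aestronglyMeasurable (Eventually.of_forall fun ω ↦
      (Real.norm_of_nonneg (Real.exp_pos _).le).trans_le (hpt2 ω))
  have hE2 : ∫ ω, Real.exp (s * A₂ ω) ∂tEns.P ≤ 1 / 2 * EZ + 1 / 2 * CK' := by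
    refine (integral_mono hI2 hmaj' hpt2).trans ?_
    rw [integral_add hIa' hIb', integral_const_mul, integral_const_mul]
    exact add_le_add (mul_le_mul_of_nonneg_left hEZ (by norm_num))
      (mul_le_mul_of_nonneg_left hK6δ'.2 (by norm_num))
  exact ⟨hI1, hE1.trans (le_max_left _ _), hI2, hE2.trans (le_max_right _ _)⟩

end Summit.CriticalPhenomena.CardyFormulaZ2.Cruxes.MagicFormulaT.LineSketch

end
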